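import Summits.QuantumFields.YangMills.Theorems.FlatTubeReductionOffTubeSuppressionPrelim
import Summits.QuantumFields.YangMills.Theorems.FemtoTransferGapPositivity
import HarnessLib

/-!
# Compressed variational values of the zero-flux `SU(2)` transfer form — bookkeeping and cut eigenfunctions
# (cruxes `LargeFieldInsensitivity` stmt-QuantumFields-25696 / `SmallFieldOctaveStep` stmt-25695, route `FemtoCutoffLadder` rev 12,
# LINE 2 «restrict-then-tighten on the field space» of seat ym-idea-1 g4; rung R2b1 = RECORD-label femto gap; seat ym-line-sfw-p1 g10)

The two children of `OctaveStepDecay` speak about the variational values of `K_β` COMPRESSED to physical zero-flux test functions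
satisfying a support constraint `P` (vanishing on a «large-field» event): `t_P = sSup (rayleighSet su2Rep L β P)` and
`s_P = sInf_φ sSup (rayleighSet su2Rep L β (P ∧ · ⊥ φ))` — the tree's `rayleighSet` with its constraint slot, NO new definition.
For an ARBITRARY constraint `P` resp. an arbitrary «good» set `T` whose cut-offs `1_T f`, `1_{Tᶜ} f` stay physical:
* §1 order bookkeeping (junk `sSup ∅ = 0` included): `0 ≤ t_P ≤ λ₀` (`sSup_rayleighSet_le_topValue`), `0 ≤ s_P ≤ λ₁`
  (`compressedSecond_le_secondValue`), witness bounds `le_sSup_rayleighSet_of_witness`, `le_compressedSecond`;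
* §2 ★ CUT GROUND STATE: `K_βΩ = λΩ`, `v = 1_TΩ`, `w = 1_{Tᶜ}Ω` ⟹ `⟨v,K_βv⟩ = λ‖Ω‖² − 2λ‖w‖² + ⟨w,K_βw⟩ ≥ λ(‖Ω‖² − 2‖w‖²)`, whence
  `t_P ≥ λ(1 − 2ε)` once `‖w‖² ≤ ε‖Ω‖²` (`le_sSup_rayleighSet_of_eigen_cut`);
* §3 ★ CUT TOP PAIR: orthonormal `K_βΩ_i = λ_iΩ_i` (`0 ≤ λ₁ ≤ λ₀`) with large-field masses `≤ ε` ⟹ `⟨v,K_βv⟩ ≥ (λ₁ − 4ελ₀)(a²+b²)` for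
  `v = 1_T(aΩ₀ + bΩ₁)` (`qform_indicator_pair_ge`), and `s_P ≥ λ₁ − 4ελ₀` (`le_compressedSecond_of_eigen_pair_cut`).
Modulo these two «easy directions with a price», `LargeFieldInsensitivity` is EXACTLY a large-field RARITY statement for the first two
transfer eigenfunctions (assembled in `FemtoCutoffLadderLargeFieldInsensitivityOfRarity.lean`).  Tools: the seat's g9 prelim
(`OffTube.isPhys_indicator`, `l2_indicator_left`, `l2_eq_indicator_add_compl`, `qform_eigen_right`, `qform_add_add`), `sq_l2_le`.

HONEST FRAMING: fixed-lattice Hilbert-space bookkeeping (any `L`, `β ≥ 0`); no rarity bound is proved here; R2b1 is a RECORD rung — nothing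
here concerns infinite volume, the continuum, or the Clay gap.  No definitions, no named facts.  [cite: ReedSimonIV1978, Thm. XIII.1]
-/

set_option autoImplicit false

noncomputable section

open MeasureTheory Filter Topology Real
open Literature.MathematicalPhysics.QuantumFieldTheory
open Literature.MathematicalPhysics.QuantumLattice

namespace Summit.QuantumFields.YangMills.Theorems.FemtoTransferGap

namespace SFCompression

open OffTube
variable {L : ℕ} [NeZero L]

/-! ## §1 Order bookkeeping for compressed variational values -/

/-- A stronger constraint gives a smaller Rayleigh set. [folklore] -/
theorem rayleighSet_mono (β : ℝ) {P Q : (GaugeConfig 3 L SU2 → ℝ) → Prop} (h : ∀ ψ, P ψ → Q ψ) :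
    rayleighSet su2Rep L β P ⊆ rayleighSet su2Rep L β Q := by
  rintro r ⟨ψ, hψ, hP, hpos, rfl⟩
  exact ⟨ψ, hψ, h ψ hP, hpos, rfl⟩

/-- `0 ≤ sSup (rayleighSet P)` (`β ≥ 0`): the empty set has `sSup ∅ = 0`, a nonempty one consists of non-negative quotients and is
bounded above. [folklore] -/
theorem sSup_rayleighSet_nonneg {β : ℝ} (hβ : 0 ≤ β) (P : (GaugeConfig 3 L SU2 → ℝ) → Prop) :
    0 ≤ sSup (rayleighSet su2Rep L β P) := by
  rcases (rayleighSet su2Rep L β P).eq_empty_or_nonempty with h | ⟨r, hr⟩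
  · rw [h, Real.sSup_empty]
  · exact (rayleigh_nonneg_fundamentalRep (n := 2) hβ hr).trans (le_csSup (bddAbove_rayleighSet_su2Rep L β P) hr)

/-- **Monotonicity of compressed top values**: a stronger constraint gives a smaller supremum (junk values included). [folklore] -/
theorem sSup_rayleighSet_mono {β : ℝ} (hβ : 0 ≤ β) {P Q : (GaugeConfig 3 L SU2 → ℝ) → Prop} (h : ∀ ψ, P ψ → Q ψ) :
    sSup (rayleighSet su2Rep L β P) ≤ sSup (rayleighSet su2Rep L β Q) := by
  rcases (rayleighSet su2Rep L β P).eq_empty_or_nonempty with hP | hP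
  · rw [hP, Real.sSup_empty]; exact sSup_rayleighSet_nonneg hβ Q
  · exact csSup_le_csSup (bddAbove_rayleighSet_su2Rep L β Q) hP (rayleighSet_mono β h)

/-- **`t_P ≤ λ₀`**: every compressed top value is at most the top value. [cite: ReedSimonIV1978, Thm. XIII.1] -/
theorem sSup_rayleighSet_le_topValue {β : ℝ} (hβ : 0 ≤ β) (P : (GaugeConfig 3 L SU2 → ℝ) → Prop) :
    sSup (rayleighSet su2Rep L β P) ≤ topValue su2Rep L β := by
  unfold topValue
  exact sSup_rayleighSet_mono hβ fun _ _ => trivial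

/-- The set of constrained suprema defining a compressed second value is nonempty (constraint `φ = 1`). [folklore] -/
theorem compressedSecondSet_nonempty (β : ℝ) (P : (GaugeConfig 3 L SU2 → ℝ) → Prop) :
    {x : ℝ | ∃ φ : GaugeConfig 3 L SU2 → ℝ, IsPhys φ ∧
      x = sSup (rayleighSet su2Rep L β fun ψ => P ψ ∧ l2 ψ φ = 0)}.Nonempty :=
  ⟨_, fun _ => 1, isPhys_const 1, rfl⟩

/-- The same set is bounded below by `0` (`β ≥ 0`). [folklore] -/
theorem compressedSecondSet_bddBelow {β : ℝ} (hβ : 0 ≤ β) (P : (GaugeConfig 3 L SU2 → ℝ) → Prop) :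
    BddBelow {x : ℝ | ∃ φ : GaugeConfig 3 L SU2 → ℝ, IsPhys φ ∧
      x = sSup (rayleighSet su2Rep L β fun ψ => P ψ ∧ l2 ψ φ = 0)} :=
  ⟨0, by rintro x ⟨φ, -, rfl⟩; exact sSup_rayleighSet_nonneg hβ _⟩

/-- **`0 ≤ s_P`**. [folklore] -/
theorem compressedSecond_nonneg {β : ℝ} (hβ : 0 ≤ β) (P : (GaugeConfig 3 L SU2 → ℝ) → Prop) :
    0 ≤ sInf {x : ℝ | ∃ φ : GaugeConfig 3 L SU2 → ℝ, IsPhys φ ∧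
      x = sSup (rayleighSet su2Rep L β fun ψ => P ψ ∧ l2 ψ φ = 0)} :=
  le_csInf (compressedSecondSet_nonempty β P) (by rintro x ⟨φ, -, rfl⟩; exact sSup_rayleighSet_nonneg hβ _)

/-- **`s_P ≤ λ₁`**: every compressed second value is at most the second value (min–max over a smaller class, same constraints).
[cite: ReedSimonIV1978, Thm. XIII.1] -/
theorem compressedSecond_le_secondValue {β : ℝ} (hβ : 0 ≤ β) (P : (GaugeConfig 3 L SU2 → ℝ) → Prop) :
    sInf {x : ℝ | ∃ φ : GaugeConfig 3 L SU2 → ℝ, IsPhys φ ∧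
      x = sSup (rayleighSet su2Rep L β fun ψ => P ψ ∧ l2 ψ φ = 0)} ≤ secondValue su2Rep L β := by
  unfold secondValue
  refine le_csInf ⟨_, fun _ => 1, isPhys_const 1, rfl⟩ ?_
  rintro s ⟨φ, hφ, rfl⟩
  exact (csInf_le (compressedSecondSet_bddBelow hβ P) ⟨φ, hφ, rfl⟩).trans (sSup_rayleighSet_mono hβ fun ψ h => h.2)

/-- A uniform lower bound on the constrained suprema bounds `s_P` from below. [folklore] -/
theorem le_compressedSecond {β m : ℝ} (P : (GaugeConfig 3 L SU2 → ℝ) → Prop)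
    (h : ∀ φ : GaugeConfig 3 L SU2 → ℝ, IsPhys φ → m ≤ sSup (rayleighSet su2Rep L β fun ψ => P ψ ∧ l2 ψ φ = 0)) :
    m ≤ sInf {x : ℝ | ∃ φ : GaugeConfig 3 L SU2 → ℝ, IsPhys φ ∧
      x = sSup (rayleighSet su2Rep L β fun ψ => P ψ ∧ l2 ψ φ = 0)} :=
  le_csInf (compressedSecondSet_nonempty β P) (by rintro x ⟨φ, hφ, rfl⟩; exact h φ hφ)

/-- **Witness bound**: an admissible `ψ` with `m‖ψ‖² ≤ ⟨ψ,K_βψ⟩` shows `m ≤ t_P`. [cite: ReedSimonIV1978, Thm. XIII.1] -/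
theorem le_sSup_rayleighSet_of_witness (β : ℝ) {P : (GaugeConfig 3 L SU2 → ℝ) → Prop} {ψ : GaugeConfig 3 L SU2 → ℝ}
    (hψ : IsPhys ψ) (hP : P ψ) (hpos : 0 < l2 ψ ψ) {m : ℝ} (hm : m * l2 ψ ψ ≤ qform su2Rep β ψ ψ) :
    m ≤ sSup (rayleighSet su2Rep L β P) :=
  ((le_div_iff₀ hpos).2 hm).trans (le_csSup (bddAbove_rayleighSet_su2Rep L β P) ⟨ψ, hψ, hP, hpos, rfl⟩)

/-- **Positivity from a witness**: an admissible `ψ` with `⟨ψ,K_βψ⟩ > 0` shows `0 < t_P`. [folklore] -/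
theorem sSup_rayleighSet_pos_of_witness (β : ℝ) {P : (GaugeConfig 3 L SU2 → ℝ) → Prop} {ψ : GaugeConfig 3 L SU2 → ℝ}
    (hψ : IsPhys ψ) (hP : P ψ) (hpos : 0 < l2 ψ ψ) (hq : 0 < qform su2Rep β ψ ψ) :
    0 < sSup (rayleighSet su2Rep L β P) :=
  (div_pos hq hpos).trans_le (le_csSup (bddAbove_rayleighSet_su2Rep L β P) ⟨ψ, hψ, hP, hpos, rfl⟩)

/-! ## §2 The cut ground state `v = 1_T Ω`, `w = 1_{Tᶜ} Ω` of an exact eigenfunction -/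

omit [NeZero L] in
/-- Indicators are linear: `1_S(a·f + b·g) = a·1_S f + b·1_S g`. [folklore] -/
theorem indicator_add_smul (S : Set (GaugeConfig 3 L SU2)) (a b : ℝ) (f g : GaugeConfig 3 L SU2 → ℝ) :
    S.indicator (a • f + b • g) = a • S.indicator f + b • S.indicator g := by
  funext U
  by_cases hU : U ∈ S
  · simp only [Set.indicator_of_mem hU, Pi.add_apply, Pi.smul_apply, smul_eq_mul]
  · simp only [Set.indicator_of_notMem hU, Pi.add_apply, Pi.smul_apply, smul_eq_mul, mul_zero, add_zero]

omit [NeZero L] in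
/-- `1_T f = f + (−1)·1_{Tᶜ} f`. [folklore] -/
theorem indicator_eq_add_neg_compl (T : Set (GaugeConfig 3 L SU2)) (f : GaugeConfig 3 L SU2 → ℝ) :
    T.indicator f = f + (-1 : ℝ) • Tᶜ.indicator f := by
  funext U
  by_cases hU : U ∈ T
  · simp only [Set.indicator_of_mem hU, Pi.add_apply, Pi.smul_apply, smul_eq_mul,
      Set.indicator_of_notMem (fun h : U ∈ Tᶜ => (Set.mem_compl_iff T U).1 h hU), mul_zero, add_zero]
  · simp only [Set.indicator_of_notMem hU, Pi.add_apply, Pi.smul_apply, smul_eq_mul,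
      Set.indicator_of_mem ((Set.mem_compl_iff T U).2 hU)]
    ring

/-- For physical `f` and physical cut `w = 1_{Tᶜ}f`: `⟨1_Tf, K_β 1_Tf⟩ = ⟨f,K_βf⟩ − 2⟨f,K_βw⟩ + ⟨w,K_βw⟩`. [folklore] -/
theorem qform_indicator_expand (β : ℝ) {T : Set (GaugeConfig 3 L SU2)} {f : GaugeConfig 3 L SU2 → ℝ}
    (hf : IsPhys f) (hw : IsPhys (Tᶜ.indicator f)) :
    qform su2Rep β (T.indicator f) (T.indicator f) =
      qform su2Rep β f f - 2 * qform su2Rep β f (Tᶜ.indicator f) + qform su2Rep β (Tᶜ.indicator f) (Tᶜ.indicator f) := by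
  rw [indicator_eq_add_neg_compl T f, qform_add_add β hf (hw.smul (-1)), qform_smul_right β (-1) hf hw,
    qform_smul_left, qform_smul_right β (-1) hw hw]
  ring

/-- For physical `f` and physical cut `w = 1_{Tᶜ}f`: `‖1_Tf‖² = ‖f‖² − ‖w‖²`. [folklore] -/
theorem l2_indicator_self_eq {T : Set (GaugeConfig 3 L SU2)} {f : GaugeConfig 3 L SU2 → ℝ}
    (hv : IsPhys (T.indicator f)) (hw : IsPhys (Tᶜ.indicator f)) :
    l2 (T.indicator f) (T.indicator f) = l2 f f - l2 (Tᶜ.indicator f) (Tᶜ.indicator f) := by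
  rw [l2_eq_indicator_add_compl (f := f) (g := f) hv hv hw hw]; ring

/-- ★ **Cut eigenfunction identity.**  `K_βΩ = λΩ`, `v = 1_TΩ`, `w = 1_{Tᶜ}Ω` (all physical):
`⟨v,K_βv⟩ = λ‖Ω‖² − 2λ‖w‖² + ⟨w,K_βw⟩` — since `⟨Ω,K_βw⟩ = λ⟨Ω,w⟩ = λ‖w‖²`. [cite: ReedSimonIV1978, Thm. XIII.1] -/
theorem qform_indicator_eigen_eq (β : ℝ) {T : Set (GaugeConfig 3 L SU2)} {lam : ℝ} {Ω : GaugeConfig 3 L SU2 → ℝ}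
    (hΩ : IsPhys Ω) (hw : IsPhys (Tᶜ.indicator Ω)) (heig : transferApply β Ω = lam • Ω) :
    qform su2Rep β (T.indicator Ω) (T.indicator Ω) =
      lam * l2 Ω Ω - 2 * lam * l2 (Tᶜ.indicator Ω) (Tᶜ.indicator Ω) + qform su2Rep β (Tᶜ.indicator Ω) (Tᶜ.indicator Ω) := by
  have h1 : qform su2Rep β Ω Ω = lam * l2 Ω Ω := qform_eigen_right β heig Ω
  have h2 : qform su2Rep β Ω (Tᶜ.indicator Ω) = lam * l2 (Tᶜ.indicator Ω) (Tᶜ.indicator Ω) := by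
    rw [qform_su2Rep_comm β hΩ hw, qform_eigen_right β heig, l2_indicator_left]
  rw [qform_indicator_expand β hΩ hw, h1, h2]
  ring

/-- ★ **Cut eigenfunction bound** (`β ≥ 0`): `⟨1_TΩ, K_β 1_TΩ⟩ ≥ λ(‖Ω‖² − 2‖1_{Tᶜ}Ω‖²)`. [cite: ReedSimonIV1978, Thm. XIII.1] -/
theorem qform_indicator_eigen_ge {β : ℝ} (hβ : 0 ≤ β) {T : Set (GaugeConfig 3 L SU2)} {lam : ℝ} {Ω : GaugeConfig 3 L SU2 → ℝ}
    (hΩ : IsPhys Ω) (hw : IsPhys (Tᶜ.indicator Ω)) (heig : transferApply β Ω = lam • Ω) :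
    lam * (l2 Ω Ω - 2 * l2 (Tᶜ.indicator Ω) (Tᶜ.indicator Ω)) ≤ qform su2Rep β (T.indicator Ω) (T.indicator Ω) := by
  rw [qform_indicator_eigen_eq β hΩ hw heig]
  have h0 : 0 ≤ qform su2Rep β (Tᶜ.indicator Ω) (Tᶜ.indicator Ω) := qform_su2Rep_self_nonneg hβ hw
  linarith

/-- ★ **Rayleigh bound for the cut eigenfunction**: if `K_βΩ = λΩ` (`λ ≥ 0`) and the large-field mass is `‖1_{Tᶜ}Ω‖² ≤ ε‖Ω‖²` with
`ε ≤ 1/2`, then `λ(1 − 2ε)·‖1_TΩ‖² ≤ ⟨1_TΩ, K_β 1_TΩ⟩`. [cite: ReedSimonIV1978, Thm. XIII.1] -/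
theorem rayleigh_indicator_eigen_ge {β : ℝ} (hβ : 0 ≤ β) {T : Set (GaugeConfig 3 L SU2)} {lam ε : ℝ} (hlam : 0 ≤ lam)
    (hε : ε ≤ 1 / 2) {Ω : GaugeConfig 3 L SU2 → ℝ} (hΩ : IsPhys Ω) (hv : IsPhys (T.indicator Ω)) (hw : IsPhys (Tᶜ.indicator Ω))
    (heig : transferApply β Ω = lam • Ω) (hmass : l2 (Tᶜ.indicator Ω) (Tᶜ.indicator Ω) ≤ ε * l2 Ω Ω) :
    lam * (1 - 2 * ε) * l2 (T.indicator Ω) (T.indicator Ω) ≤ qform su2Rep β (T.indicator Ω) (T.indicator Ω) := by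
  have hge := qform_indicator_eigen_ge hβ (T := T) hΩ hw heig
  have hvle : l2 (T.indicator Ω) (T.indicator Ω) ≤ l2 Ω Ω := l2_indicator_self_le hv hw
  have hN : 0 ≤ l2 Ω Ω := l2_self_nonneg Ω
  have h12 : 0 ≤ 1 - 2 * ε := by linarith
  calc lam * (1 - 2 * ε) * l2 (T.indicator Ω) (T.indicator Ω)
      ≤ lam * (1 - 2 * ε) * l2 Ω Ω := mul_le_mul_of_nonneg_left hvle (mul_nonneg hlam h12)
    _ = lam * (l2 Ω Ω - 2 * (ε * l2 Ω Ω)) := by ring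
    _ ≤ lam * (l2 Ω Ω - 2 * l2 (Tᶜ.indicator Ω) (Tᶜ.indicator Ω)) :=
        mul_le_mul_of_nonneg_left (by linarith) hlam
    _ ≤ _ := hge

/-- ★ **`t_P ≥ λ(1 − 2ε)` from ONE cut eigenfunction**: if `K_βΩ = λΩ` (`λ ≥ 0`, `‖Ω‖² > 0`), `1_TΩ` satisfies the constraint `P`, and
`‖1_{Tᶜ}Ω‖² ≤ ε‖Ω‖²` with `ε < 1/2`, then `λ(1 − 2ε) ≤ sSup (rayleighSet P)`. [cite: ReedSimonIV1978, Thm. XIII.1] -/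
theorem le_sSup_rayleighSet_of_eigen_cut {β : ℝ} (hβ : 0 ≤ β) {P : (GaugeConfig 3 L SU2 → ℝ) → Prop}
    {T : Set (GaugeConfig 3 L SU2)} {lam ε : ℝ} (hlam : 0 ≤ lam) (hε : ε < 1 / 2)
    {Ω : GaugeConfig 3 L SU2 → ℝ} (hΩ : IsPhys Ω) (hv : IsPhys (T.indicator Ω)) (hw : IsPhys (Tᶜ.indicator Ω))
    (hP : P (T.indicator Ω)) (hN : 0 < l2 Ω Ω)
    (heig : transferApply β Ω = lam • Ω) (hmass : l2 (Tᶜ.indicator Ω) (Tᶜ.indicator Ω) ≤ ε * l2 Ω Ω) :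
    lam * (1 - 2 * ε) ≤ sSup (rayleighSet su2Rep L β P) := by
  have hvpos : 0 < l2 (T.indicator Ω) (T.indicator Ω) := by
    rw [l2_indicator_self_eq hv hw]
    have : ε * l2 Ω Ω < l2 Ω Ω := by nlinarith
    linarith
  exact le_sSup_rayleighSet_of_witness β hv hP hvpos (rayleigh_indicator_eigen_ge hβ hlam hε.le hΩ hv hw heig hmass)

/-! ## §3 The cut top pair `1_T(aΩ₀ + bΩ₁)` -/

/-- `⟨a·f, b·g⟩ = ab⟨f,g⟩`. [folklore] -/
theorem l2_smul_smul (a b : ℝ) (f g : GaugeConfig 3 L SU2 → ℝ) : l2 (a • f) (b • g) = a * b * l2 f g := by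
  rw [l2_smul_left, l2_comm f (b • g), l2_smul_left, l2_comm g f]; ring

/-- `‖aΩ₀ + bΩ₁‖² = a² + b²` for an `l2`-orthonormal pair. [folklore] -/
theorem l2_pair_self {Ω₀ Ω₁ : GaugeConfig 3 L SU2 → ℝ} (hΩ₀ : IsPhys Ω₀) (hΩ₁ : IsPhys Ω₁)
    (hn₀ : l2 Ω₀ Ω₀ = 1) (hn₁ : l2 Ω₁ Ω₁ = 1) (horth : l2 Ω₀ Ω₁ = 0) (a b : ℝ) :
    l2 (a • Ω₀ + b • Ω₁) (a • Ω₀ + b • Ω₁) = a ^ 2 + b ^ 2 := by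
  rw [l2_add_add (hΩ₀.smul a) (hΩ₁.smul b), l2_smul_smul, l2_smul_smul, l2_smul_smul, hn₀, hn₁, horth]; ring

/-- `‖a·u + b·v‖² ≤ 2(a² + b²)·ε` when `‖u‖², ‖v‖² ≤ ε` (Cauchy–Schwarz and `2|ab| ≤ a² + b²`). [folklore] -/
theorem l2_add_smul_self_le {u v : GaugeConfig 3 L SU2 → ℝ} (hu : IsPhys u) (hv : IsPhys v) {ε : ℝ}
    (hue : l2 u u ≤ ε) (hve : l2 v v ≤ ε) (a b : ℝ) :
    l2 (a • u + b • v) (a • u + b • v) ≤ 2 * (a ^ 2 + b ^ 2) * ε := by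
  have hε : 0 ≤ ε := (l2_self_nonneg u).trans hue
  have hexp : l2 (a • u + b • v) (a • u + b • v) = a ^ 2 * l2 u u + 2 * (a * b) * l2 u v + b ^ 2 * l2 v v := by
    rw [l2_add_add (hu.smul a) (hv.smul b), l2_smul_smul, l2_smul_smul, l2_smul_smul]
    ring
  have hcs : (l2 u v) ^ 2 ≤ ε ^ 2 := by
    calc (l2 u v) ^ 2 ≤ l2 u u * l2 v v := sq_l2_le hu hv
      _ ≤ ε * ε := mul_le_mul hue hve (l2_self_nonneg v) hε
      _ = ε ^ 2 := (sq ε).symm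
  have habs : |l2 u v| ≤ ε := (pow_le_pow_iff_left₀ (abs_nonneg (l2 u v)) hε two_ne_zero).1 (by rwa [sq_abs])
  have hx1 : 0 ≤ ε + l2 u v := by linarith [(abs_le.mp habs).1]
  have hx2 : 0 ≤ ε - l2 u v := by linarith [(abs_le.mp habs).2]
  rw [hexp]
  nlinarith [mul_nonneg (sq_nonneg (a - b)) hx1, mul_nonneg (sq_nonneg (a + b)) hx2,
    mul_le_mul_of_nonneg_left hue (sq_nonneg a), mul_le_mul_of_nonneg_left hve (sq_nonneg b)]

/-- ★★ **Cut top pair.**  `Ω₀, Ω₁` physical, `l2`-orthonormal exact eigenfunctions `K_βΩ_i = λ_iΩ_i` with `0 ≤ λ₁ ≤ λ₀`, whose large-field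
masses satisfy `‖1_{Tᶜ}Ω_i‖² ≤ ε`; then for all `a, b`, the cut combination `v = 1_T(aΩ₀ + bΩ₁)` obeys
`⟨v, K_β v⟩ ≥ (λ₁ − 4ελ₀)(a² + b²)`: expand `⟨v,Kv⟩ = ⟨χ,Kχ⟩ − 2⟨χ,Kw⟩ + ⟨w,Kw⟩` (`χ = aΩ₀ + bΩ₁`, `w = 1_{Tᶜ}χ`), use
`⟨χ,Kχ⟩ = a²λ₀ + b²λ₁ ≥ λ₁(a²+b²)`, `⟨w,Kw⟩ ≥ 0`, and `⟨χ,Kw⟩ = ⟨w, aλ₀·1_{Tᶜ}Ω₀ + bλ₁·1_{Tᶜ}Ω₁⟩ ≤ 2ελ₀(a²+b²)` by Cauchy–Schwarz.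
[cite: ReedSimonIV1978, Thm. XIII.1] -/
theorem qform_indicator_pair_ge {β : ℝ} (hβ : 0 ≤ β) {T : Set (GaugeConfig 3 L SU2)}
    (hT : ∀ {f : GaugeConfig 3 L SU2 → ℝ}, IsPhys f → IsPhys (T.indicator f) ∧ IsPhys (Tᶜ.indicator f))
    {lam₀ lam₁ ε : ℝ} (hlam₁ : 0 ≤ lam₁) (hlam : lam₁ ≤ lam₀)
    {Ω₀ Ω₁ : GaugeConfig 3 L SU2 → ℝ} (hΩ₀ : IsPhys Ω₀) (hΩ₁ : IsPhys Ω₁)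
    (hn₀ : l2 Ω₀ Ω₀ = 1) (hn₁ : l2 Ω₁ Ω₁ = 1) (horth : l2 Ω₀ Ω₁ = 0)
    (heig₀ : transferApply β Ω₀ = lam₀ • Ω₀) (heig₁ : transferApply β Ω₁ = lam₁ • Ω₁)
    (hm₀ : l2 (Tᶜ.indicator Ω₀) (Tᶜ.indicator Ω₀) ≤ ε) (hm₁ : l2 (Tᶜ.indicator Ω₁) (Tᶜ.indicator Ω₁) ≤ ε) (a b : ℝ) :
    (lam₁ - 4 * ε * lam₀) * (a ^ 2 + b ^ 2) ≤
      qform su2Rep β (T.indicator (a • Ω₀ + b • Ω₁)) (T.indicator (a • Ω₀ + b • Ω₁)) := by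
  have hlam₀ : 0 ≤ lam₀ := hlam₁.trans hlam
  have hε : 0 ≤ ε := (l2_self_nonneg _).trans hm₀
  set χ := a • Ω₀ + b • Ω₁ with hχdef
  have hχ : IsPhys χ := (hΩ₀.smul a).add (hΩ₁.smul b)
  set w := Tᶜ.indicator χ with hwdef
  have hw : IsPhys w := (hT hχ).2
  set w₀ := Tᶜ.indicator Ω₀ with hw₀def
  set w₁ := Tᶜ.indicator Ω₁ with hw₁def
  have hw₀ : IsPhys w₀ := (hT hΩ₀).2
  have hw₁ : IsPhys w₁ := (hT hΩ₁).2
  -- `⟨χ,Kχ⟩ = a²λ₀ + b²λ₁`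
  have hq₀₀ : qform su2Rep β Ω₀ Ω₀ = lam₀ := by rw [qform_eigen_right β heig₀, hn₀, mul_one]
  have hq₁₁ : qform su2Rep β Ω₁ Ω₁ = lam₁ := by rw [qform_eigen_right β heig₁, hn₁, mul_one]
  have hq₀₁ : qform su2Rep β Ω₀ Ω₁ = 0 := by rw [qform_eigen_right β heig₁, horth, mul_zero]
  have hχχ : qform su2Rep β χ χ = a ^ 2 * lam₀ + b ^ 2 * lam₁ := by
    rw [hχdef, qform_add_add β (hΩ₀.smul a) (hΩ₁.smul b), qform_smul_left, qform_smul_right β a hΩ₀ hΩ₀, hq₀₀,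
      qform_smul_left, qform_smul_right β b hΩ₀ hΩ₁, hq₀₁, qform_smul_left, qform_smul_right β b hΩ₁ hΩ₁, hq₁₁]
    ring
  -- `⟨χ,Kw⟩ = ⟨w, aλ₀w₀ + bλ₁w₁⟩`
  have hcross : qform su2Rep β χ w = l2 w ((a * lam₀) • w₀ + (b * lam₁) • w₁) := by
    have e0 : qform su2Rep β Ω₀ w = lam₀ * l2 w w₀ := by
      rw [qform_su2Rep_comm β hΩ₀ hw, qform_eigen_right β heig₀, hwdef, l2_indicator_left]
    have e1 : qform su2Rep β Ω₁ w = lam₁ * l2 w w₁ := by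
      rw [qform_su2Rep_comm β hΩ₁ hw, qform_eigen_right β heig₁, hwdef, l2_indicator_left]
    rw [hχdef, qform_add_left β (hΩ₀.smul a) (hΩ₁.smul b) hw, qform_smul_left, qform_smul_left, e0, e1,
      l2_comm w (_ + _), l2_add_left (hw₀.smul _) (hw₁.smul _) hw, l2_smul_left, l2_smul_left, l2_comm w₀ w, l2_comm w₁ w]
    ring
  -- sizes of the two cut vectors
  have hw_eq : w = a • w₀ + b • w₁ := by rw [hwdef, hχdef, indicator_add_smul]
  have hww : l2 w w ≤ 2 * (a ^ 2 + b ^ 2) * ε := by rw [hw_eq]; exact l2_add_smul_self_le hw₀ hw₁ hm₀ hm₁ a b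
  have hgg : l2 ((a * lam₀) • w₀ + (b * lam₁) • w₁) ((a * lam₀) • w₀ + (b * lam₁) • w₁) ≤
      2 * (a ^ 2 + b ^ 2) * lam₀ ^ 2 * ε := by
    have h := l2_add_smul_self_le hw₀ hw₁ hm₀ hm₁ (a * lam₀) (b * lam₁)
    have hl : (a * lam₀) ^ 2 + (b * lam₁) ^ 2 ≤ (a ^ 2 + b ^ 2) * lam₀ ^ 2 := by
      have : lam₁ ^ 2 ≤ lam₀ ^ 2 := pow_le_pow_left₀ hlam₁ hlam 2
      nlinarith [sq_nonneg a, sq_nonneg b]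
    calc _ ≤ 2 * ((a * lam₀) ^ 2 + (b * lam₁) ^ 2) * ε := h
      _ ≤ 2 * ((a ^ 2 + b ^ 2) * lam₀ ^ 2) * ε := by
          exact mul_le_mul_of_nonneg_right (mul_le_mul_of_nonneg_left hl (by norm_num)) hε
      _ = 2 * (a ^ 2 + b ^ 2) * lam₀ ^ 2 * ε := by ring
  -- Cauchy–Schwarz: `⟨χ,Kw⟩ ≤ 2ελ₀(a²+b²)`
  set M := 2 * ε * lam₀ * (a ^ 2 + b ^ 2) with hMdef
  have hM0 : 0 ≤ M := by rw [hMdef]; positivity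
  have hcross_sq : (qform su2Rep β χ w) ^ 2 ≤ M ^ 2 := by
    rw [hcross]
    calc _ ≤ l2 w w * l2 ((a * lam₀) • w₀ + (b * lam₁) • w₁) ((a * lam₀) • w₀ + (b * lam₁) • w₁) :=
          sq_l2_le hw ((hw₀.smul _).add (hw₁.smul _))
      _ ≤ (2 * (a ^ 2 + b ^ 2) * ε) * (2 * (a ^ 2 + b ^ 2) * lam₀ ^ 2 * ε) :=
          mul_le_mul hww hgg (l2_self_nonneg _) (by positivity)
      _ = M ^ 2 := by rw [hMdef]; ring
  have hcross_le : qform su2Rep β χ w ≤ M := by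
    have h := (pow_le_pow_iff_left₀ (abs_nonneg (qform su2Rep β χ w)) hM0 two_ne_zero).1 (by rwa [sq_abs])
    exact (le_abs_self _).trans h
  -- assemble
  have hexp := qform_indicator_expand β (T := T) hχ hw
  have hwwq : 0 ≤ qform su2Rep β w w := qform_su2Rep_self_nonneg hβ hw
  have hmain : lam₁ * (a ^ 2 + b ^ 2) ≤ qform su2Rep β χ χ := by
    rw [hχχ]; nlinarith [sq_nonneg a, sq_nonneg b]
  rw [hexp]
  have : (lam₁ - 4 * ε * lam₀) * (a ^ 2 + b ^ 2) = lam₁ * (a ^ 2 + b ^ 2) - 2 * M := by rw [hMdef]; ring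
  rw [this]
  linarith

/-- The cut combination is not too small: `‖1_T(aΩ₀ + bΩ₁)‖² ≥ (1 − 2ε)(a² + b²)`. [folklore] -/
theorem l2_indicator_pair_ge {T : Set (GaugeConfig 3 L SU2)}
    (hT : ∀ {f : GaugeConfig 3 L SU2 → ℝ}, IsPhys f → IsPhys (T.indicator f) ∧ IsPhys (Tᶜ.indicator f))
    {ε : ℝ} {Ω₀ Ω₁ : GaugeConfig 3 L SU2 → ℝ} (hΩ₀ : IsPhys Ω₀) (hΩ₁ : IsPhys Ω₁)
    (hn₀ : l2 Ω₀ Ω₀ = 1) (hn₁ : l2 Ω₁ Ω₁ = 1) (horth : l2 Ω₀ Ω₁ = 0)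
    (hm₀ : l2 (Tᶜ.indicator Ω₀) (Tᶜ.indicator Ω₀) ≤ ε) (hm₁ : l2 (Tᶜ.indicator Ω₁) (Tᶜ.indicator Ω₁) ≤ ε) (a b : ℝ) :
    (1 - 2 * ε) * (a ^ 2 + b ^ 2) ≤ l2 (T.indicator (a • Ω₀ + b • Ω₁)) (T.indicator (a • Ω₀ + b • Ω₁)) := by
  set χ := a • Ω₀ + b • Ω₁ with hχdef
  have hχ : IsPhys χ := (hΩ₀.smul a).add (hΩ₁.smul b)
  have hχχ : l2 χ χ = a ^ 2 + b ^ 2 := by rw [hχdef]; exact l2_pair_self hΩ₀ hΩ₁ hn₀ hn₁ horth a b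
  have hw_eq : Tᶜ.indicator χ = a • Tᶜ.indicator Ω₀ + b • Tᶜ.indicator Ω₁ := by rw [hχdef, indicator_add_smul]
  have hww : l2 (Tᶜ.indicator χ) (Tᶜ.indicator χ) ≤ 2 * (a ^ 2 + b ^ 2) * ε := by
    rw [hw_eq]; exact l2_add_smul_self_le (hT hΩ₀).2 (hT hΩ₁).2 hm₀ hm₁ a b
  rw [l2_indicator_self_eq (hT hχ).1 (hT hχ).2, hχχ]
  linarith

/-- ★★ **Rayleigh bound for the cut pair**: under the hypotheses of `qform_indicator_pair_ge` and `ε < 1/2`, `(a,b) ≠ (0,0)`: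
`(λ₁ − 4ελ₀)·‖v‖² ≤ ⟨v,K_βv⟩` and `0 < ‖v‖²` for `v = 1_T(aΩ₀ + bΩ₁)`. [cite: ReedSimonIV1978, Thm. XIII.1] -/
theorem rayleigh_indicator_pair_ge {β : ℝ} (hβ : 0 ≤ β) {T : Set (GaugeConfig 3 L SU2)}
    (hT : ∀ {f : GaugeConfig 3 L SU2 → ℝ}, IsPhys f → IsPhys (T.indicator f) ∧ IsPhys (Tᶜ.indicator f))
    {lam₀ lam₁ ε : ℝ} (hlam₁ : 0 ≤ lam₁) (hlam : lam₁ ≤ lam₀) (hε : ε < 1 / 2)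
    {Ω₀ Ω₁ : GaugeConfig 3 L SU2 → ℝ} (hΩ₀ : IsPhys Ω₀) (hΩ₁ : IsPhys Ω₁)
    (hn₀ : l2 Ω₀ Ω₀ = 1) (hn₁ : l2 Ω₁ Ω₁ = 1) (horth : l2 Ω₀ Ω₁ = 0)
    (heig₀ : transferApply β Ω₀ = lam₀ • Ω₀) (heig₁ : transferApply β Ω₁ = lam₁ • Ω₁)
    (hm₀ : l2 (Tᶜ.indicator Ω₀) (Tᶜ.indicator Ω₀) ≤ ε) (hm₁ : l2 (Tᶜ.indicator Ω₁) (Tᶜ.indicator Ω₁) ≤ ε)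
    {a b : ℝ} (hab : a ^ 2 + b ^ 2 ≠ 0) :
    0 < l2 (T.indicator (a • Ω₀ + b • Ω₁)) (T.indicator (a • Ω₀ + b • Ω₁)) ∧
      (lam₁ - 4 * ε * lam₀) * l2 (T.indicator (a • Ω₀ + b • Ω₁)) (T.indicator (a • Ω₀ + b • Ω₁)) ≤
        qform su2Rep β (T.indicator (a • Ω₀ + b • Ω₁)) (T.indicator (a • Ω₀ + b • Ω₁)) := by
  have hn : 0 < a ^ 2 + b ^ 2 := lt_of_le_of_ne (by positivity) (Ne.symm hab)
  have hlow := l2_indicator_pair_ge hT hΩ₀ hΩ₁ hn₀ hn₁ horth hm₀ hm₁ a b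
  have hq := qform_indicator_pair_ge hβ hT hlam₁ hlam hΩ₀ hΩ₁ hn₀ hn₁ horth heig₀ heig₁ hm₀ hm₁ a b
  have hχ : IsPhys (a • Ω₀ + b • Ω₁) := (hΩ₀.smul a).add (hΩ₁.smul b)
  have hvle : l2 (T.indicator (a • Ω₀ + b • Ω₁)) (T.indicator (a • Ω₀ + b • Ω₁)) ≤ a ^ 2 + b ^ 2 := by
    have h := l2_indicator_self_le (hT hχ).1 (hT hχ).2
    have hχχ : l2 (a • Ω₀ + b • Ω₁) (a • Ω₀ + b • Ω₁) = a ^ 2 + b ^ 2 := l2_pair_self hΩ₀ hΩ₁ hn₀ hn₁ horth a b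
    rwa [hχχ] at h
  have hvpos : 0 < l2 (T.indicator (a • Ω₀ + b • Ω₁)) (T.indicator (a • Ω₀ + b • Ω₁)) := by
    have : 0 < (1 - 2 * ε) * (a ^ 2 + b ^ 2) := mul_pos (by linarith) hn
    linarith
  refine ⟨hvpos, ?_⟩
  rcases le_or_gt (lam₁ - 4 * ε * lam₀) 0 with hneg | hpos
  · exact (mul_nonpos_of_nonpos_of_nonneg hneg hvpos.le).trans (qform_su2Rep_self_nonneg hβ (hT hχ).1)
  · exact (mul_le_mul_of_nonneg_left hvle hpos.le).trans hq

/-- ★★ **`s_P ≥ λ₁ − 4ελ₀` from the cut top pair.**  If every cut `1_T f` satisfies the constraint `P`, then under the hypotheses of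
`rayleigh_indicator_pair_ge` the compressed second value is at least `λ₁ − 4ελ₀`: for each physical constraint `φ` the two-dimensional
family `1_T(aΩ₀ + bΩ₁)` contains a non-zero vector orthogonal to `φ`. [cite: ReedSimonIV1978, Thm. XIII.1] -/
theorem le_compressedSecond_of_eigen_pair_cut {β : ℝ} (hβ : 0 ≤ β) {P : (GaugeConfig 3 L SU2 → ℝ) → Prop}
    {T : Set (GaugeConfig 3 L SU2)}
    (hT : ∀ {f : GaugeConfig 3 L SU2 → ℝ}, IsPhys f → IsPhys (T.indicator f) ∧ IsPhys (Tᶜ.indicator f))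
    (hP : ∀ f : GaugeConfig 3 L SU2 → ℝ, P (T.indicator f))
    {lam₀ lam₁ ε : ℝ} (hlam₁ : 0 ≤ lam₁) (hlam : lam₁ ≤ lam₀) (hε : ε < 1 / 2)
    {Ω₀ Ω₁ : GaugeConfig 3 L SU2 → ℝ} (hΩ₀ : IsPhys Ω₀) (hΩ₁ : IsPhys Ω₁)
    (hn₀ : l2 Ω₀ Ω₀ = 1) (hn₁ : l2 Ω₁ Ω₁ = 1) (horth : l2 Ω₀ Ω₁ = 0)
    (heig₀ : transferApply β Ω₀ = lam₀ • Ω₀) (heig₁ : transferApply β Ω₁ = lam₁ • Ω₁)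
    (hm₀ : l2 (Tᶜ.indicator Ω₀) (Tᶜ.indicator Ω₀) ≤ ε) (hm₁ : l2 (Tᶜ.indicator Ω₁) (Tᶜ.indicator Ω₁) ≤ ε) :
    lam₁ - 4 * ε * lam₀ ≤ sInf {x : ℝ | ∃ φ : GaugeConfig 3 L SU2 → ℝ, IsPhys φ ∧
      x = sSup (rayleighSet su2Rep L β fun ψ => P ψ ∧ l2 ψ φ = 0)} := by
  refine le_compressedSecond P fun φ hφ => ?_
  -- coefficients orthogonal to `φ`
  set p := l2 (T.indicator Ω₀) φ with hpdef
  set q := l2 (T.indicator Ω₁) φ with hqdef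
  have horthv : ∀ a b : ℝ, l2 (T.indicator (a • Ω₀ + b • Ω₁)) φ = a * p + b * q := by
    intro a b
    rw [indicator_add_smul, l2_add_left ((hT hΩ₀).1.smul a) ((hT hΩ₁).1.smul b) hφ, l2_smul_left, l2_smul_left]
  -- choose `(a,b) = (q, -p)` unless both vanish, then `(1, 0)`
  obtain ⟨a, b, hab, hzero⟩ : ∃ a b : ℝ, a ^ 2 + b ^ 2 ≠ 0 ∧ a * p + b * q = 0 := by
    by_cases h : p ^ 2 + q ^ 2 = 0
    · have hp : p = 0 := by nlinarith [sq_nonneg p, sq_nonneg q]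
      have hq : q = 0 := by nlinarith [sq_nonneg p, sq_nonneg q]
      exact ⟨1, 0, by norm_num, by rw [hp, hq]; ring⟩
    · exact ⟨q, -p, by rwa [neg_sq, add_comm], by ring⟩
  obtain ⟨hvpos, hray⟩ :=
    rayleigh_indicator_pair_ge hβ hT hlam₁ hlam hε hΩ₀ hΩ₁ hn₀ hn₁ horth heig₀ heig₁ hm₀ hm₁ hab
  have hχ : IsPhys (a • Ω₀ + b • Ω₁) := (hΩ₀.smul a).add (hΩ₁.smul b)
  exact le_sSup_rayleighSet_of_witness β (hT hχ).1 ⟨hP _, by rw [horthv, hzero]⟩ hvpos hray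

end SFCompression

end Summit.QuantumFields.YangMills.Theorems.FemtoTransferGap

end
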